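import Literature.IUT.LogVolume.ExplicitEstimatesHeightsComparison
import Literature.IUT.LogVolume.ExplicitEstimatesTheorem54
import HarnessLib

/-!
# [ExpEst] Theorem 5.3 (ii) FROM Theorem 5.3 (i): Claims 5.3A–C of the printed proof, kernel-checked

S. Mochizuki, I. Fesenko, Y. Hoshi, A. Minamide, W. Porowski, *Explicit estimates in inter-universal
Teichmüller theory*, Kodai Math. J. **45** (2022) 175–236 — [ExpEst], bib key `MochizukiEtAl2022` (D-0012
claim key, status disputed). **Theorem 5.3, proof of (ii)** (Claims 5.3A, 5.3B, 5.3C): p. 220–221 (pdf p46.l11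
– p47.l22 of the cell render `run/shared/lean/pub/abc-iut/plan/repair/lit/renders/MFHMP-ExplicitEstimates-
Kodai2022-book-anonnd-eeiutp`; journal page = pdf page + 174).

PROOF-ONLY file (cell abc-iut, seat lit-abc-explicitiut gen 3): no definition, no named fact. TAKES NO SIDE on
[IUTchIII] Corollary 3.12 or on any author; typed ≠ proved ≠ endorsed; no abc claim. What is PROVED is the
printed implication between the two halves of the claim-tagged candidate `ExpEst.Thm53i` / `ExpEst.Thm53ii`
(`ExplicitEstimatesTheorem53.lean` [claim: MochizukiEtAl2022, status: disputed]) over an arbitrary mono-complex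
number field `L`:

  `thm53ii_of_thm53i : Thm53i L a b c ε → Thm53ii L a b c ε`,

by the printed route: **Claim 5.3A** (`d·h^tor_non(b/c) = ½·log|bc|_w + Σ_{v ∤ ∞} log max{|a|_v,|b|_v,|c|_v}`,
product formula + `|a|_v ≤ max{|b|_v,|c|_v}` — `claim53A`), **Claim 5.3B** (`‖b/c‖_w ≥ ½` for `‖a‖_w ≤ ‖b‖_w ≤
‖c‖_w` — inside `claim53C_ordered`), **Claim 5.3C** (`(1/6)·h_non(j(E_{a,b,c})) ≥ (2/(3d))·log H_L(a,b,c) −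
(5/3)·log 2` — `claim53C`, from `(∗₁)` = Lemma 1.3 (i), (iv) + Prop. 1.8 (i) + Remark 1.10.1 (here: the
symmetrized toric height of `λ = −a/c`, `hStorNon_legendre`, and `ExpEst.hStorNon_sub_hNon_jInv_bounds`) and
`(∗₂)` = Claim 5.3A at the archimedean maximum). The printed "we may assume without loss of generality that
`‖a‖_w ≤ ‖b‖_w ≤ ‖c‖_w`" is discharged by the `𝔖₃`-symmetry of `H_L` (Mathlib `Height.mulHeight_comp_equiv`) and
of `j(E_{a,b,c}) = 2^5·(a²+b²+c²)³/(abc)²` (`jInv_neg_div_eq_symm`; the closed form is symmetric because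
`2(a² + ac + c²) = a² + b² + c²` when `a + b + c = 0`). Together with `ExplicitEstimatesTheorem54.lean`
(`IUTDisputedClaim_of_thm53i`), both printed consequences of Theorem 5.3 (i) — Theorem 5.3 (ii) and Theorem 5.4
— are now kernel-checked implications; Theorem 5.3 (i) itself ("immediately from Corollary 5.2 … Remark
1.10.1") stays a claim-tagged hypothesis, downstream of the disputed [IUTchIII] Cor. 3.12.

Rendering as in `ExplicitEstimatesTheorem53.lean`: `H_L(a,b,c)` = `Height.mulHeight ![a, b, c]`, `|x|_w =
(w x)^{mult w}` at the (unique) archimedean place, `d = [L:ℚ] = mult w` for mono-complex `L`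
(`ExpEst.IsMonoComplex`).
-/

noncomputable section

open scoped Classical

namespace Literature.IUT.LogVolume

namespace ExpEst

open NumberField Real Cor22 Height

/-! ## 0. Plumbing: finite support, `⨆` over `Fin 3`, `log max{s/t, t/s}` -/

variable {L : Type*} [Field L] [NumberField L]

/-- For `α ≠ 0`, a finite set of finite places containing those with `|α|_w ≠ 1`. [folklore] -/
private theorem exists_finset_places₃ {α : L} (hα : α ≠ 0) :
    ∃ S : Finset (FinitePlace L), ∀ w : FinitePlace L, w α ≠ 1 → w ∈ S := by
  have hfin : (Function.mulSupport fun w : FinitePlace L => w α).Finite :=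
    FinitePlace.hasFiniteMulSupport hα
  exact ⟨hfin.toFinset, fun w hw => hfin.mem_toFinset.mpr hw⟩

/-- A sum over all finite places of a function vanishing off a finite set `S` is the sum over `S`. [folklore] -/
private theorem finsum_eq_sum_of_eq_zero_off₃ (S : Finset (FinitePlace L)) (g : FinitePlace L → ℝ)
    (hg : ∀ w, w ∉ S → g w = 0) : ∑ᶠ w, g w = ∑ w ∈ S, g w :=
  finsum_eq_sum_of_support_subset g fun w hw => by
    rw [Finset.mem_coe]; by_contra h; exact hw (hg w h)

/-- `[L:ℚ] > 0` as a real number. [folklore] -/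
private theorem finrank_pos₃ : (0 : ℝ) < Module.finrank ℚ L := by
  exact_mod_cast Module.finrank_pos

omit [NumberField L] in
/-- `⨆_{i ∈ Fin 3} f i = max{f 0, f 1, f 2}` in `ℝ`. [folklore] -/
private theorem ciSup_fin_three (f : Fin 3 → ℝ) : (⨆ i, f i) = max (f 0) (max (f 1) (f 2)) :=
  le_antisymm (ciSup_le fun i => by fin_cases i <;> simp)
    (max_le (le_ciSup (Finite.bddAbove_range f) 0)
      (max_le (le_ciSup (Finite.bddAbove_range f) 1) (le_ciSup (Finite.bddAbove_range f) 2)))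

omit [NumberField L] in
/-- `log max{s/t, t/s} = 2·log max{s, t} − log s − log t` for `s, t > 0` (the computation
"`log max{|b/c|_v, |c/b|_v} = log(|bc|_v^{-1}·max{|b|_v², |c|_v²})`" of the proof of Claim 5.3A, p. 220).
[cite: MochizukiEtAl2022, Thm 5.3 proof, Claim 5.3A p. 220] -/
private theorem log_max_div_self {s t : ℝ} (hs : 0 < s) (ht : 0 < t) :
    Real.log (max (s / t) (s / t)⁻¹) = 2 * Real.log (max s t) - Real.log s - Real.log t := by
  rw [inv_div]
  rcases le_total s t with h | h
  · have h1 : s / t ≤ t / s := by rw [div_le_div_iff₀ ht hs]; nlinarith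
    rw [max_eq_right h1, max_eq_right h, Real.log_div ht.ne' hs.ne']; ring
  · have h1 : t / s ≤ s / t := by rw [div_le_div_iff₀ hs ht]; nlinarith
    rw [max_eq_left h1, max_eq_left h, Real.log_div hs.ne' ht.ne']; ring

/-! ## 1. The `𝔖₃`-symmetry of `j(E_{a,b,c})` -/

section Field

variable {K : Type*} [Field K]

/-- `j(E_{a,b,c}) = 2^8·(a² + ac + c²)³/(abc)²` for `a + b + c = 0`, `abc ≠ 0` (any field; the case `K = ℚ` is
`ExpEst.jInv_neg_div_triple`): the `j`-invariant of `y² = x(x−1)(x + a/c)`, `λ = −a/c`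
[cite: SilvermanAEC2009, Prop. III.1.7(b)]. [cite: MochizukiEtAl2022, Thm 5.3 p. 219] -/
theorem jInv_neg_div_eq {a b c : K} (hb : b ≠ 0) (hc : c ≠ 0) (h : a + b + c = 0) :
    jInv (-(a / c)) = 2 ^ 8 * (a ^ 2 + a * c + c ^ 2) ^ 3 / (a * b * c) ^ 2 := by
  have hb' : b = -(a + c) := by linear_combination h
  have hac : a + c ≠ 0 := by
    intro h0; apply hb; rw [hb', h0, neg_zero]
  have h1 : (-(a / c)) ^ 2 * (-(a / c) - 1) ^ 2 = (a * (a + c) / c ^ 2) ^ 2 := by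
    field_simp
    ring
  have h2 : (-(a / c)) ^ 2 - -(a / c) + 1 = (a ^ 2 + a * c + c ^ 2) / c ^ 2 := by
    field_simp
    ring
  unfold jInv
  rw [h1, h2, hb']
  field_simp

/-- The symmetric closed form: `j(E_{a,b,c}) = 2^5·(a² + b² + c²)³/(abc)²` (`2·(a² + ac + c²) = a² + b² + c²`
when `a + b + c = 0`), which makes the `𝔖₃`-invariance of `j(E_{a,b,c})` under permutations of `(a, b, c)`
manifest ("we may assume without loss of generality that `‖a‖_w ≤ ‖b‖_w ≤ ‖c‖_w`", p. 220).
[cite: MochizukiEtAl2022, Thm 5.3 proof p. 220] -/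
theorem jInv_neg_div_eq_symm {a b c : K} (hb : b ≠ 0) (hc : c ≠ 0) (h : a + b + c = 0) :
    jInv (-(a / c)) = 2 ^ 5 * (a ^ 2 + b ^ 2 + c ^ 2) ^ 3 / (a * b * c) ^ 2 := by
  rw [jInv_neg_div_eq hb hc h]
  have hb' : b = -(a + c) := by linear_combination h
  rw [hb']
  ring

/-- `j(E_{b,a,c}) = j(E_{a,b,c})`. [cite: MochizukiEtAl2022, Thm 5.3 proof p. 220] -/
theorem jInv_legendre_swap₁₂ {a b c : K} (ha : a ≠ 0) (hb : b ≠ 0) (hc : c ≠ 0) (h : a + b + c = 0) :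
    jInv (-(b / c)) = jInv (-(a / c)) := by
  rw [jInv_neg_div_eq_symm ha hc (by linear_combination h), jInv_neg_div_eq_symm hb hc h]
  ring

/-- `j(E_{a,c,b}) = j(E_{a,b,c})`. [cite: MochizukiEtAl2022, Thm 5.3 proof p. 220] -/
theorem jInv_legendre_swap₂₃ {a b c : K} (hb : b ≠ 0) (hc : c ≠ 0) (h : a + b + c = 0) :
    jInv (-(a / b)) = jInv (-(a / c)) := by
  rw [jInv_neg_div_eq_symm hc hb (by linear_combination h), jInv_neg_div_eq_symm hb hc h]
  ring

/-- `j(E_{b,c,a}) = j(E_{a,b,c})`. [cite: MochizukiEtAl2022, Thm 5.3 proof p. 220] -/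
theorem jInv_legendre_cycle {a b c : K} (ha : a ≠ 0) (hb : b ≠ 0) (hc : c ≠ 0) (h : a + b + c = 0) :
    jInv (-(b / a)) = jInv (-(a / c)) := by
  rw [jInv_neg_div_eq_symm hc ha (by linear_combination h), jInv_neg_div_eq_symm hb hc h]
  ring

end Field

/-! ## 2. `(∗₁)`: the symmetrized toric height of `λ = −a/c` -/

/-- Toric heights do not see signs: `h^tor_non(−x) = h^tor_non(x)`. [cite: MochizukiEtAl2022, Def 1.1 (ii) p. 184] -/
theorem hTorNon_neg (x : L) : hTorNon (-x) = hTorNon x := by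
  unfold hTorNon
  congr 1
  exact finsum_congr fun w => by rw [map_neg_eq_map]

/-- For `λ = −a/c` with `a + b + c = 0`: `h^{𝔖-tor}_non(E_{a,b,c}) = 2·(h^tor_non(a/c) + h^tor_non(b/c) + h^tor_non(b/a))`
(`1 − λ = −b/c`, `λ(λ−1)^{-1} = −a/b`; Lemma 1.3 (i) and sign-invariance) — the quantity of display `(∗₁)`, p. 221.
[cite: MochizukiEtAl2022, Thm 5.3 proof, (∗₁) p. 221] -/
theorem hStorNon_legendre {a b c : L} (ha : a ≠ 0) (hb : b ≠ 0) (hc : c ≠ 0) (h : a + b + c = 0) :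
    hStorNon (-(a / c)) = 2 * (hTorNon (a / c) + hTorNon (b / c) + hTorNon (b / a)) := by
  have hb' : b = -(a + c) := by linear_combination h
  have hac : a + c ≠ 0 := by
    intro h0; apply hb; rw [hb', h0, neg_zero]
  have e1 : 1 - -(a / c) = -(b / c) := by rw [hb']; field_simp; ring
  have e2 : -(a / c) / (-(a / c) - 1) = -(a / b) := by
    rw [hb']
    have : -(a / c) - 1 = -((a + c) / c) := by field_simp; ring
    rw [this, neg_div_neg_eq, div_div_div_cancel_right₀ hc]
    field_simp
  rw [hStorNon_eq, e1, e2, hTorNon_neg, hTorNon_neg, hTorNon_neg,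
    show a / b = (b / a)⁻¹ from (inv_div b a).symm, hTorNon_inv]

/-- **`(∗₁)`** (p. 221): "`(1/6)·h_non(j(E_{a,b,c})) + (4/3)·log 2 ≥ (1/3)·(h^tor_non(a/c) + h^tor_non(b/c) +
h^tor_non(b/a))`" — Prop. 1.8 (i) for `λ = −a/c`. [cite: MochizukiEtAl2022, Thm 5.3 proof, (∗₁) p. 221] -/
theorem star₁ {a b c : L} (ha : a ≠ 0) (hb : b ≠ 0) (hc : c ≠ 0) (h : a + b + c = 0) :
    1 / 3 * (hTorNon (a / c) + hTorNon (b / c) + hTorNon (b / a)) ≤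
      1 / 6 * hNon (jInv (-(a / c))) + 4 / 3 * Real.log 2 := by
  have h0 : -(a / c) ≠ 0 := neg_ne_zero.mpr (div_ne_zero ha hc)
  have h1 : -(a / c) ≠ 1 := by
    intro h1
    apply hb
    have : a = -c := by field_simp at h1; linear_combination -h1
    linear_combination h - this
  have h8 := (hStorNon_sub_hNon_jInv_bounds (-(a / c)) h0 h1).2
  rw [hStorNon_legendre ha hb hc h] at h8
  linarith

/-- The second inequality of `(∗₁)` (p. 221): "`≥ (2/3)·h^tor_non(b/c)`" (Lemma 1.3 (iv): `h^tor(a/c) + h^tor(b/a) ≥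
h^tor(b/c)`). [cite: MochizukiEtAl2022, Thm 5.3 proof, (∗₁) p. 221] -/
theorem star₁' {a b c : L} (ha : a ≠ 0) (hb : b ≠ 0) (hc : c ≠ 0) :
    2 / 3 * hTorNon (b / c) ≤ 1 / 3 * (hTorNon (a / c) + hTorNon (b / c) + hTorNon (b / a)) := by
  have h := hTorNon_mul_le (a / c) (b / a) (div_ne_zero ha hc) (div_ne_zero hb ha)
  rw [show a / c * (b / a) = b / c by field_simp] at h
  linarith

/-! ## 3. `H_L(a,b,c)` as a sum over places; Claim 5.3A -/

/-- `log H_L(a,b,c) = Σ_{w ∣ ∞} m_w·log max{w a, w b, w c} + Σ_{v ∤ ∞} log max{|a|_v, |b|_v, |c|_v}` (Mathlib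
`NumberField.mulHeight_eq`), the finite part as a sum over any finite set of places off which `|a|_v = |b|_v =
|c|_v = 1`. [cite: MochizukiEtAl2022, Thm 5.3 p. 219] -/
theorem log_mulHeight_three {a b c : L} (ha : a ≠ 0) (S : Finset (FinitePlace L))
    (hoff : ∀ v : FinitePlace L, v ∉ S → v a = 1 ∧ v b = 1 ∧ v c = 1) :
    Real.log (mulHeight ![a, b, c]) =
      (∑ w : InfinitePlace L, (w.mult : ℝ) * Real.log (max (w a) (max (w b) (w c)))) +
        ∑ v ∈ S, Real.log (max (v a) (max (v b) (v c))) := by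
  have hx : ![a, b, c] ≠ 0 := by
    intro h0; exact ha (by simpa using congrFun h0 0)
  rw [NumberField.mulHeight_eq hx]
  simp only [ciSup_fin_three, Matrix.cons_val_zero, Matrix.cons_val_one, Matrix.cons_val]
  have hsupp : (Function.mulSupport fun v : FinitePlace L => max (v a) (max (v b) (v c))) ⊆ S := by
    intro v hv
    rw [Finset.mem_coe]
    by_contra h
    obtain ⟨h1, h2, h3⟩ := hoff v h
    exact hv (by simp [h1, h2, h3])
  rw [finprod_eq_prod_of_mulSupport_subset _ hsupp]
  have hpos1 : ∀ w ∈ (Finset.univ : Finset (InfinitePlace L)),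
      max (w a) (max (w b) (w c)) ^ w.mult ≠ 0 :=
    fun w _ => pow_ne_zero _ (lt_max_of_lt_left (InfinitePlace.pos_iff.mpr ha)).ne'
  have hpos2 : ∀ v ∈ S, max (v a) (max (v b) (v c)) ≠ 0 :=
    fun v _ => (lt_max_of_lt_left (FinitePlace.pos_iff.mpr ha)).ne'
  rw [Real.log_mul (Finset.prod_ne_zero_iff.mpr hpos1) (Finset.prod_ne_zero_iff.mpr hpos2),
    Real.log_prod hpos1, Real.log_prod hpos2]
  simp only [Real.log_pow]

/-- **Claim 5.3A** (p. 220): for a mono-complex `L` with archimedean place `w`, `a + b + c = 0` in `L^×`: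
"`d·h^tor_non(b/c) = ½·log|bc|_w + Σ_{v ∈ 𝕍(L)^non} log max{|a|_v, |b|_v, |c|_v}`" (`|bc|_w = (w b·w c)^{m_w}`); proof as
printed: `max{|b/c|_v, |c/b|_v} = |bc|_v^{-1}·max{|b|_v², |c|_v²}`, the product formula, and `|a|_v = |b + c|_v ≤
max{|b|_v, |c|_v}`. The finite sum is written over any finite set of places off which `|a|_v = |b|_v = |c|_v = 1`.
[cite: MochizukiEtAl2022, Thm 5.3 proof, Claim 5.3A p. 220] -/
theorem claim53A {w₀ : InfinitePlace L} (hw₀ : ∀ w : InfinitePlace L, w = w₀) {a b c : L}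
    (hb : b ≠ 0) (hc : c ≠ 0) (h : a + b + c = 0) (S : Finset (FinitePlace L))
    (hoff : ∀ v : FinitePlace L, v ∉ S → v a = 1 ∧ v b = 1 ∧ v c = 1) :
    (Module.finrank ℚ L : ℝ) * hTorNon (b / c) =
      1 / 2 * ((w₀.mult : ℝ) * (Real.log (w₀ b) + Real.log (w₀ c))) +
        ∑ v ∈ S, Real.log (max (v a) (max (v b) (v c))) := by
  have hd := finrank_pos₃ (L := L)
  -- product formula for `b` and `c`, unique archimedean place
  have hpb := sum_mult_log_add_finsum_log hb
  have hpc := sum_mult_log_add_finsum_log hc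
  rw [Fintype.sum_eq_single w₀ (fun w hw => absurd (hw₀ w) hw),
    finsum_eq_sum_of_eq_zero_off₃ S _ (fun v hv => by rw [(hoff v hv).2.1, Real.log_one])] at hpb
  rw [Fintype.sum_eq_single w₀ (fun w hw => absurd (hw₀ w) hw),
    finsum_eq_sum_of_eq_zero_off₃ S _ (fun v hv => by rw [(hoff v hv).2.2, Real.log_one])] at hpc
  -- the toric sum as a sum over `S`
  have e1 : ∑ᶠ v : FinitePlace L, Real.log (max (v (b / c)) (v (b / c))⁻¹) =
      ∑ v ∈ S, Real.log (max (v (b / c)) (v (b / c))⁻¹) :=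
    finsum_eq_sum_of_eq_zero_off₃ S _ fun v hv => by
      rw [map_div₀, (hoff v hv).2.1, (hoff v hv).2.2]; simp
  -- place by place
  have hpt : ∀ v ∈ S, Real.log (max (v (b / c)) (v (b / c))⁻¹) =
      2 * Real.log (max (v a) (max (v b) (v c))) - Real.log (v b) - Real.log (v c) := by
    intro v _
    have hva : v a ≤ max (v b) (v c) := by
      rw [show a = -(b + c) by linear_combination h, map_neg_eq_map]
      exact FinitePlace.add_le v b c
    rw [map_div₀, log_max_div_self (FinitePlace.pos_iff.mpr hb) (FinitePlace.pos_iff.mpr hc),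
      max_eq_right hva]
  unfold hTorNon
  rw [e1, Finset.sum_congr rfl hpt, Finset.sum_sub_distrib, Finset.sum_sub_distrib, ← Finset.mul_sum]
  rw [show (Module.finrank ℚ L : ℝ) * ((2 * (Module.finrank ℚ L : ℝ))⁻¹ *
      (2 * ∑ v ∈ S, Real.log (max (v a) (max (v b) (v c))) - ∑ v ∈ S, Real.log (v b) -
        ∑ v ∈ S, Real.log (v c))) =
      ∑ v ∈ S, Real.log (max (v a) (max (v b) (v c))) -
        1 / 2 * (∑ v ∈ S, Real.log (v b) + ∑ v ∈ S, Real.log (v c)) by field_simp; ring]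
  linarith

/-! ## 4. Claim 5.3C -/

/-- **Claim 5.3C under the printed normalisation `‖a‖_w ≤ ‖b‖_w ≤ ‖c‖_w`** (p. 220–221): "`(1/6)·h_non(j(E_{a,b,c})) ≥
(2/(3d))·log H_L(a,b,c) − (5/3)·log 2`" — from `(∗₁)`, Lemma 1.3 (iv), `(∗₂)` (= Claim 5.3A rewritten through `log H_L
= m_w·log‖c‖_w + Σ_{v ∤ ∞} log max`), and Claim 5.3B (`‖b/c‖_w ≥ ½`, as `‖c‖_w ≤ ‖a‖_w + ‖b‖_w ≤ 2‖b‖_w`).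
[cite: MochizukiEtAl2022, Thm 5.3 proof, Claim 5.3C p. 220–221] -/
theorem claim53C_ordered {w₀ : InfinitePlace L} (hw₀ : ∀ w : InfinitePlace L, w = w₀)
    {a b c : L} (ha : a ≠ 0) (hb : b ≠ 0) (hc : c ≠ 0) (h : a + b + c = 0)
    (hab : w₀ a ≤ w₀ b) (hbc : w₀ b ≤ w₀ c) :
    2 / (3 * (Module.finrank ℚ L : ℝ)) * Real.log (mulHeight ![a, b, c]) - 5 / 3 * Real.log 2 ≤
      1 / 6 * hNon (jInv (-(a / c))) := by
  have hd := finrank_pos₃ (L := L)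
  set d : ℝ := (Module.finrank ℚ L : ℝ) with hdd
  -- `m_{w₀} = d`
  have hmult : (w₀.mult : ℝ) = d := by
    have hs := InfinitePlace.sum_mult_eq (K := L)
    rw [Fintype.sum_eq_single w₀ (fun w hw => absurd (hw₀ w) hw)] at hs
    rw [hdd]; exact_mod_cast hs
  -- a common finite set of places
  obtain ⟨S1, hS1⟩ := exists_finset_places₃ ha
  obtain ⟨S2, hS2⟩ := exists_finset_places₃ hb
  obtain ⟨S3, hS3⟩ := exists_finset_places₃ hc
  set S := S1 ∪ S2 ∪ S3 with hSdef
  have hoff : ∀ v : FinitePlace L, v ∉ S → v a = 1 ∧ v b = 1 ∧ v c = 1 := by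
    intro v hv
    refine ⟨by_contra fun h' => hv ?_, by_contra fun h' => hv ?_, by_contra fun h' => hv ?_⟩
    · rw [hSdef, Finset.mem_union, Finset.mem_union]; exact Or.inl (Or.inl (hS1 v h'))
    · rw [hSdef, Finset.mem_union, Finset.mem_union]; exact Or.inl (Or.inr (hS2 v h'))
    · rw [hSdef, Finset.mem_union]; exact Or.inr (hS3 v h')
  -- `(∗₁)` and Lemma 1.3 (iv)
  have s1 := star₁ ha hb hc h
  have s1' := star₁' ha hb hc
  -- `(∗₂)`: Claim 5.3A and `log H_L`
  have hA := claim53A hw₀ hb hc h S hoff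
  have hH := log_mulHeight_three (b := b) (c := c) ha S hoff
  rw [Fintype.sum_eq_single w₀ (fun w hw => absurd (hw₀ w) hw),
    max_eq_right hbc, max_eq_right (hab.trans hbc)] at hH
  -- Claim 5.3B: `‖c‖_w ≤ 2‖b‖_w`
  have hb0 : 0 < w₀ b := InfinitePlace.pos_iff.mpr hb
  have hc0 : 0 < w₀ c := InfinitePlace.pos_iff.mpr hc
  have h53B : w₀ c ≤ 2 * w₀ b := by
    have htri : w₀ (a + b) ≤ w₀ a + w₀ b := w₀.val.add_le a b
    have hneg : w₀ c = w₀ (a + b) := by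
      rw [show c = -(a + b) by linear_combination h]; exact w₀.val.map_neg (a + b)
    rw [hneg]; linarith
  have hlog : -Real.log 2 ≤ Real.log (w₀ b) - Real.log (w₀ c) := by
    have := Real.log_le_log hc0 h53B
    rw [Real.log_mul (by norm_num) hb0.ne'] at this
    linarith
  -- `(∗₂)`: `d·h^tor_non(b/c) ≥ log H_L − (d/2)·log 2`
  have hT : Real.log (mulHeight ![a, b, c]) - d / 2 * Real.log 2 ≤ d * hTorNon (b / c) := by
    rw [hA, hH, hmult]
    have := mul_le_mul_of_nonneg_left hlog (by linarith : (0 : ℝ) ≤ d / 2)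
    linarith
  -- assemble
  have F12 : 2 / 3 * hTorNon (b / c) ≤ 1 / 6 * hNon (jInv (-(a / c))) + 4 / 3 * Real.log 2 := by
    linarith
  have F12d := mul_le_mul_of_nonneg_left F12 hd.le
  have key : 2 / 3 * Real.log (mulHeight ![a, b, c]) ≤
      d * (1 / 6 * hNon (jInv (-(a / c))) + 5 / 3 * Real.log 2) := by
    linarith
  have e : 2 / (3 * d) * Real.log (mulHeight ![a, b, c]) = 2 / 3 * Real.log (mulHeight ![a, b, c]) / d := by
    field_simp
  rw [e, sub_le_iff_le_add, div_le_iff₀ hd]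
  linarith

/-- `H_L` as products of `max{|a|_v, |b|_v, |c|_v}` (Mathlib `NumberField.mulHeight_eq`). [cite: MochizukiEtAl2022, Thm 5.3 p. 219] -/
private theorem mulHeight_three_eq (a b c : L) (ha : a ≠ 0) :
    mulHeight ![a, b, c] =
      (∏ w : InfinitePlace L, (max (w a) (max (w b) (w c))) ^ w.mult) *
        ∏ᶠ v : FinitePlace L, max (v a) (max (v b) (v c)) := by
  have hx : ![a, b, c] ≠ 0 := by
    intro h0; exact ha (by simpa using congrFun h0 0)
  rw [NumberField.mulHeight_eq hx]
  simp only [ciSup_fin_three, Matrix.cons_val_zero, Matrix.cons_val_one, Matrix.cons_val]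

/-- `H_L(b,a,c) = H_L(a,b,c)`. [cite: MochizukiEtAl2022, Thm 5.3 p. 219] -/
theorem mulHeight_three_swap₁₂ {a b c : L} (ha : a ≠ 0) (hb : b ≠ 0) :
    mulHeight ![b, a, c] = mulHeight ![a, b, c] := by
  rw [mulHeight_three_eq b a c hb, mulHeight_three_eq a b c ha]
  simp only [max_left_comm]

/-- `H_L(a,c,b) = H_L(a,b,c)`. [cite: MochizukiEtAl2022, Thm 5.3 p. 219] -/
theorem mulHeight_three_swap₂₃ {a b c : L} (ha : a ≠ 0) :
    mulHeight ![a, c, b] = mulHeight ![a, b, c] := by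
  rw [mulHeight_three_eq a c b ha, mulHeight_three_eq a b c ha]
  simp only [max_comm]

/-- `H_L(b,c,a) = H_L(a,b,c)`. [cite: MochizukiEtAl2022, Thm 5.3 p. 219] -/
theorem mulHeight_three_cycle {a b c : L} (ha : a ≠ 0) (hb : b ≠ 0) :
    mulHeight ![b, c, a] = mulHeight ![a, b, c] := by
  rw [mulHeight_three_eq b c a hb, mulHeight_three_eq a b c ha]
  simp only [max_comm, max_left_comm]

/-- Claim 5.3C when `‖c‖_w` is the archimedean maximum (the case `‖b‖_w ≤ ‖a‖_w` reduced to the printed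
normalisation by the symmetry `(a, b, c) ↦ (b, a, c)`). [cite: MochizukiEtAl2022, Thm 5.3 proof, Claim 5.3C p. 220–221] -/
theorem claim53C_max {w₀ : InfinitePlace L} (hw₀ : ∀ w : InfinitePlace L, w = w₀)
    {a b c : L} (ha : a ≠ 0) (hb : b ≠ 0) (hc : c ≠ 0) (h : a + b + c = 0)
    (hac : w₀ a ≤ w₀ c) (hbc : w₀ b ≤ w₀ c) :
    2 / (3 * (Module.finrank ℚ L : ℝ)) * Real.log (mulHeight ![a, b, c]) - 5 / 3 * Real.log 2 ≤
      1 / 6 * hNon (jInv (-(a / c))) := by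
  rcases le_total (w₀ a) (w₀ b) with hab | hba
  · exact claim53C_ordered hw₀ ha hb hc h hab hbc
  · have h' := claim53C_ordered hw₀ hb ha hc (by linear_combination h) hba hac
    rw [jInv_legendre_swap₁₂ ha hb hc h, mulHeight_three_swap₁₂ ha hb] at h'
    exact h'

/-- **Claim 5.3C** (p. 220–221), for ANY labelling of the triple: "`(1/6)·h_non(j(E_{a,b,c})) ≥ (2/(3d))·log H_L(a,b,c)
− (5/3)·log 2`" — the printed normalisation "`‖a‖_w ≤ ‖b‖_w ≤ ‖c‖_w` without loss of generality" is discharged by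
the `𝔖₃`-symmetry of `H_L(a,b,c)` and of `j(E_{a,b,c})`. [cite: MochizukiEtAl2022, Thm 5.3 proof, Claim 5.3C p. 220–221] -/
theorem claim53C (hL : IsMonoComplex L) {a b c : L} (ha : a ≠ 0) (hb : b ≠ 0) (hc : c ≠ 0)
    (h : a + b + c = 0) :
    2 / (3 * (Module.finrank ℚ L : ℝ)) * Real.log (mulHeight ![a, b, c]) - 5 / 3 * Real.log 2 ≤
      1 / 6 * hNon (jInv (-(a / c))) := by
  obtain ⟨w₀, hw₀⟩ := Fintype.card_eq_one_iff.mp hL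
  rcases le_total (w₀ b) (w₀ c) with hbc | hcb
  · rcases le_total (w₀ a) (w₀ c) with hac | hca
    · exact claim53C_max hw₀ ha hb hc h hac hbc
    · -- `‖a‖_w` is the maximum: use the triple `(b, c, a)`
      have h' := claim53C_max hw₀ hb hc ha (by linear_combination h) (hbc.trans hca) hca
      rw [jInv_legendre_cycle ha hb hc h, mulHeight_three_cycle ha hb] at h'
      exact h'
  · rcases le_total (w₀ a) (w₀ b) with hab | hba
    · -- `‖b‖_w` is the maximum: use the triple `(a, c, b)`
      have h' := claim53C_max hw₀ ha hc hb (by linear_combination h) hab hcb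
      rw [jInv_legendre_swap₂₃ hb hc h, mulHeight_three_swap₂₃ ha] at h'
      exact h'
    · -- `‖a‖_w` is the maximum again
      have h' := claim53C_max hw₀ hb hc ha (by linear_combination h) hba (hcb.trans hba)
      rw [jInv_legendre_cycle ha hb hc h, mulHeight_three_cycle ha hb] at h'
      exact h'

/-! ## 5. Theorem 5.3 (ii) from Theorem 5.3 (i) -/

/-- `Δ_L ≥ 1` (`Δ_L = |disc L| ≠ 0`). [cite: MochizukiEtAl2022, Thm 5.3 p. 219] -/
theorem one_le_absDisc (L : Type*) [Field L] [NumberField L] : 1 ≤ absDisc L := by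
  unfold absDisc
  exact Int.natAbs_pos.mpr (NumberField.discr_ne_zero L)

/-- **[ExpEst] Theorem 5.3 (ii) FROM Theorem 5.3 (i)** (p. 221: "in light of assertion (i) and Claim 5.3C, we
obtain that `log(H_L(a,b,c)) ≤ max{(d/4)·h_d(ε), (3/2)(1+ε)·log(Δ_L·rad_L(a,b,c))} + (5d/2)·log 2`. This completes the
proof of assertion (ii)."): for every mono-complex `L`, `a, b, c, ε`, the candidate predicate `Thm53i L a b c ε`
implies `Thm53ii L a b c ε`. An IMPLICATION between typed candidates; neither side asserted; no side taken on
[IUTchIII] Cor. 3.12. [cite: MochizukiEtAl2022, Thm 5.3 (ii) proof p. 220–221] -/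
theorem thm53ii_of_thm53i {a b c : L} {ε : ℝ} (H53 : Thm53i L a b c ε) : Thm53ii L a b c ε := by
  intro hL ha hb hc hsum hε hε1
  have hi := H53 hL ha hb hc hsum hε hε1
  have hC := claim53C hL ha hb hc hsum
  have hdpos := finrank_pos₃ (L := L)
  set d : ℝ := (Module.finrank ℚ L : ℝ) with hdd
  set Hh : ℝ := mulHeight ![a, b, c] with hHh
  set X : ℝ := (absDisc L : ℝ) * (radL a b c : ℝ) with hX
  set B : ℝ := hd (Module.finrank ℚ L) ε with hB
  have hH0 : 0 < Hh := mulHeight_pos _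
  have hX1 : 1 ≤ X := by
    rw [hX]
    have h1 : (1 : ℝ) ≤ (absDisc L : ℝ) := by exact_mod_cast one_le_absDisc L
    have h2 : (1 : ℝ) ≤ (radL a b c : ℝ) := by exact_mod_cast one_le_radL a b c
    nlinarith
  have hX0 : 0 < X := by linarith
  -- from Claim 5.3C and (i): `(2/3)·log H ≤ d·(max{…} + (5/3)·log 2)`
  have hCM : 2 / (3 * d) * Real.log Hh - 5 / 3 * Real.log 2 ≤
      max (d⁻¹ * (1 + ε) * Real.log X) (1 / 6 * B) := hC.trans hi
  have e : 2 / (3 * d) * Real.log Hh = 2 / 3 * Real.log Hh / d := by field_simp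
  rw [e, sub_le_iff_le_add, div_le_iff₀ hdpos] at hCM
  -- exponentiate
  have hexp2 : Real.exp (5 * d / 2 * Real.log 2) = (2 : ℝ) ^ (5 * d / 2) := by
    rw [Real.rpow_def_of_pos (by norm_num : (0 : ℝ) < 2), mul_comm]
  have hexpX : Real.exp (3 * (1 + ε) / 2 * Real.log X) = X ^ (3 * (1 + ε) / 2) := by
    rw [Real.rpow_def_of_pos hX0, mul_comm]
  have hHexp : Hh = Real.exp (Real.log Hh) := (Real.exp_log hH0).symm
  rw [hHexp]
  rcases le_total (d⁻¹ * (1 + ε) * Real.log X) (1 / 6 * B) with hle | hle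
  · rw [max_eq_right hle] at hCM
    have hlog : Real.log Hh ≤ d / 4 * B + 5 * d / 2 * Real.log 2 := by nlinarith
    calc Real.exp (Real.log Hh) ≤ Real.exp (d / 4 * B + 5 * d / 2 * Real.log 2) :=
          Real.exp_le_exp.mpr hlog
      _ = (2 : ℝ) ^ (5 * d / 2) * Real.exp (d / 4 * B) := by rw [Real.exp_add, hexp2, mul_comm]
      _ ≤ (2 : ℝ) ^ (5 * d / 2) * max (Real.exp (d / 4 * B)) (X ^ (3 * (1 + ε) / 2)) :=
          mul_le_mul_of_nonneg_left (le_max_left _ _) (by positivity)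
  · rw [max_eq_left hle] at hCM
    have hdd' : (d⁻¹ * (1 + ε) * Real.log X + 5 / 3 * Real.log 2) * d =
        (1 + ε) * Real.log X + 5 / 3 * Real.log 2 * d := by field_simp
    rw [hdd'] at hCM
    have hlog : Real.log Hh ≤ 3 * (1 + ε) / 2 * Real.log X + 5 * d / 2 * Real.log 2 := by nlinarith
    calc Real.exp (Real.log Hh) ≤ Real.exp (3 * (1 + ε) / 2 * Real.log X + 5 * d / 2 * Real.log 2) :=
          Real.exp_le_exp.mpr hlog
      _ = (2 : ℝ) ^ (5 * d / 2) * X ^ (3 * (1 + ε) / 2) := by rw [Real.exp_add, hexp2, hexpX, mul_comm]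
      _ ≤ (2 : ℝ) ^ (5 * d / 2) * max (Real.exp (d / 4 * B)) (X ^ (3 * (1 + ε) / 2)) :=
          mul_le_mul_of_nonneg_left (le_max_right _ _) (by positivity)

end ExpEst

end Literature.IUT.LogVolume

end
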